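import Summits.QuantumFields.YangMills.Theorems.FluctuationComparisonRegPrIntLS2BetaExpChartLipschitzOffCap
import HarnessLib

/-!
# (BG∞) ∕ UV3-NODE §116 (G4)-GEOM — A `3r`-SEPARATED GRID OF `n³` POINTS IN `SU(2)` (for `6·r·n ≤ 1`): the cubic grid of spacing `(3π∕2)·r` in the log chart, inside the
# ball of radius `π∕2`, read through `expPoint`; separation by the hemisphere co-Lipschitz bound of the log chart (✓p838790 (G5) at `r = π∕2`)

Cell `ym3-torus` (YM ladder rung R3 = continuum `SU(2)` Yang–Mills on the three-torus — a RUNG: NOT d = 4, NOT infinite volume, NOT a mass gap, NOT Clay).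
LEAD-20520 `ym-ust-20520-w3` (gen 29); explicit-unit helper on the crux `stmt-QuantumFields-20520` (`--supports`, count-neutral).  DEFINITION-FREE.

WHAT.  The GEOMETRIC half of §116.4 (G4) (px19 g25's (BG∞) plan of record; the COMBINATORIAL half is ✓p838931 `…FarPointPigeonhole.exists_far_point_of_cover`):
★★ `exists_separated_grid (hr : 0 < r) (hfit : 6 * r * n ≤ 1) : ∃ P : Finset SU2, P.card = n ^ 3 ∧ ∀ p ∈ P, ∀ p′ ∈ P, p ≠ p′ → 3 * r ≤ dist1 (p * p′⁻¹)` — the points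
`expPoint (s • (i, j, k))`, `s = (3π∕2)·r`, `i j k < n`: they lie in the log ball of radius `π∕2` (`‖·‖ ≤ √3·s·(n−1) ≤ 2·s·n ≤ π∕2` by `hfit`), two distinct grid vectors
differ by `≥ s` in norm (one coordinate differs by `≥ s`), and the log chart is `(π∕2)`-co-Lipschitz on that ball in `dist1` (✓p838790 `norm_sub_le_mul_dist1_expPoint` at
`r = π∕2`, `sin(π∕2) = 1`), so `dist1 ≥ (2∕π)·s = 3r`; in particular the grid map is injective and `P.card = n³`.  With ✓p838931 this closes (G4) modulo the patch count:
a `3r`-separated family of `n³ ≈ 1∕(216 r³)` points beats any patch family of fewer members (§116.3 (G4): `#patches ≲ 30λ²∕r²`, so `r ≲ 1∕(6500 λ²)` suffices —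
«horrible but universal», as §116 says; FL-39's truth is `C ≈ 1`).

HONEST FRAMING.  Elementary chart geometry; nothing of Bałaban's; (BG∞)∕`hBG` a CONJECTURE under construction; GAP♯∘ ∕ S2β ∕ 20520 ∕ `YM3TorusSU2` NOT proved; rung R3 —
NOT d = 4, NOT infinite volume, NOT a mass gap, NOT Clay.  Sorry-free; axioms standard; default heartbeats.
-/

set_option autoImplicit false

noncomputable section

namespace Summit.QuantumFields.YangMills.Theorems.FluctuationComparisonRegPrIntLS2BetaSeparatedGridSU2

open scoped Real
open Literature.MathematicalPhysics.QuantumFieldTheory.Balaban1983to89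
open T4CubeChartGnomonic (SU2)
open T4HaarSU2ExpChart (expPoint)
open Summit.QuantumFields.YangMills.Theorems.FluctuationComparisonRegPrIntLS2BetaExpChartLipschitzOffCap (norm_sub_le_mul_dist1_expPoint)

/-- ★★ **A `3r`-SEPARATED GRID OF `n³` POINTS IN SU(2)** (for `0 < r`, `6·r·n ≤ 1`): the image of the log-chart grid of spacing `(3π∕2)·r` under `expPoint`. [folklore] -/
theorem exists_separated_grid {r : ℝ} (hr : 0 < r) {n : ℕ} (hfit : 6 * r * n ≤ 1) :
    ∃ P : Finset SU2, P.card = n ^ 3 ∧ ∀ p ∈ P, ∀ p' ∈ P, p ≠ p' → 3 * r ≤ dist1 (p * p'⁻¹) := by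
  classical
  set s : ℝ := 3 * π / 2 * r with hs
  have hs0 : 0 ≤ s := by rw [hs]; positivity
  -- the grid vectors `s • (i, j, k)` in the log chart
  set v : Fin n × Fin n × Fin n → EuclideanSpace ℝ (Fin 3) :=
    fun t => (WithLp.equiv 2 (Fin 3 → ℝ)).symm ![s * (t.1 : ℕ), s * (t.2.1 : ℕ), s * (t.2.2 : ℕ)] with hv
  have hv0 : ∀ t, v t 0 = s * (t.1 : ℕ) := fun t => rfl
  have hv1 : ∀ t, v t 1 = s * (t.2.1 : ℕ) := fun t => rfl
  have hv2 : ∀ t, v t 2 = s * (t.2.2 : ℕ) := fun t => rfl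
  -- norms: `‖v t‖ ≤ 2·s·n ≤ π∕2`
  have hnorm : ∀ t, ‖v t‖ ≤ 2 * s * n := by
    intro t
    have h1 : ((t.1 : ℕ) : ℝ) ≤ n := by exact_mod_cast t.1.isLt.le
    have h2 : ((t.2.1 : ℕ) : ℝ) ≤ n := by exact_mod_cast t.2.1.isLt.le
    have h3 : ((t.2.2 : ℕ) : ℝ) ≤ n := by exact_mod_cast t.2.2.isLt.le
    have h0a : (0 : ℝ) ≤ (t.1 : ℕ) := Nat.cast_nonneg _
    have h0b : (0 : ℝ) ≤ (t.2.1 : ℕ) := Nat.cast_nonneg _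
    have h0c : (0 : ℝ) ≤ (t.2.2 : ℕ) := Nat.cast_nonneg _
    have hsq : ‖v t‖ ^ 2 ≤ (2 * s * n) ^ 2 := by
      rw [EuclideanSpace.real_norm_sq_eq, Fin.sum_univ_three, hv0, hv1, hv2]
      have ha : (s * (t.1 : ℕ)) ^ 2 ≤ (s * n) ^ 2 := by gcongr
      have hb : (s * (t.2.1 : ℕ)) ^ 2 ≤ (s * n) ^ 2 := by gcongr
      have hc : (s * (t.2.2 : ℕ)) ^ 2 ≤ (s * n) ^ 2 := by gcongr
      nlinarith [sq_nonneg (s * n)]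
    exact (pow_le_pow_iff_left₀ (norm_nonneg _) (by positivity) two_ne_zero).1 hsq
  have hball : ∀ t, ‖v t‖ ≤ π - π / 2 := by
    intro t
    refine (hnorm t).trans ?_
    have : 2 * s * n = 3 * π * (r * n) := by rw [hs]; ring
    rw [this]
    have hrn : r * (n : ℝ) ≤ 1 / 6 := by nlinarith [hr]
    nlinarith [Real.pi_pos]
  -- separation in the chart: distinct grid vectors differ by `≥ s`
  have hsepv : ∀ t t', t ≠ t' → s ≤ ‖v t - v t'‖ := by
    intro t t' htt
    have hsq : ‖v t - v t'‖ ^ 2 =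
        (s * ((t.1 : ℕ) - (t'.1 : ℕ) : ℝ)) ^ 2 + (s * ((t.2.1 : ℕ) - (t'.2.1 : ℕ) : ℝ)) ^ 2 + (s * ((t.2.2 : ℕ) - (t'.2.2 : ℕ) : ℝ)) ^ 2 := by
      rw [EuclideanSpace.real_norm_sq_eq, Fin.sum_univ_three]
      simp only [PiLp.sub_apply, hv0, hv1, hv2]
      ring
    have key : ∀ (a b : ℕ), a ≠ b → s ^ 2 ≤ (s * ((a : ℝ) - (b : ℝ))) ^ 2 := by
      intro a b hab
      have h1 : (1 : ℝ) ≤ ((a : ℝ) - (b : ℝ)) ^ 2 := by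
        rcases lt_or_gt_of_ne hab with h | h
        · have : (a : ℝ) + 1 ≤ b := by exact_mod_cast h
          nlinarith
        · have : (b : ℝ) + 1 ≤ a := by exact_mod_cast h
          nlinarith
      nlinarith [sq_nonneg s]
    have hone : s ^ 2 ≤ ‖v t - v t'‖ ^ 2 := by
      rw [hsq]
      have n1 := sq_nonneg (s * ((t.1 : ℕ) - (t'.1 : ℕ) : ℝ))
      have n2 := sq_nonneg (s * ((t.2.1 : ℕ) - (t'.2.1 : ℕ) : ℝ))
      have n3 := sq_nonneg (s * ((t.2.2 : ℕ) - (t'.2.2 : ℕ) : ℝ))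
      by_cases h1 : (t.1 : ℕ) = (t'.1 : ℕ)
      · by_cases h2 : (t.2.1 : ℕ) = (t'.2.1 : ℕ)
        · have h3 : (t.2.2 : ℕ) ≠ (t'.2.2 : ℕ) := by
            intro h3
            exact htt (Prod.ext (Fin.ext h1) (Prod.ext (Fin.ext h2) (Fin.ext h3)))
          have := key _ _ h3
          linarith
        · have := key _ _ h2
          linarith
      · have := key _ _ h1
        linarith
    exact (pow_le_pow_iff_left₀ hs0 (norm_nonneg _) two_ne_zero).1 hone
  -- separation of the images in `dist1`, by the hemisphere co-Lipschitz bound of the log chart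
  have hsep : ∀ t t', t ≠ t' → 3 * r ≤ dist1 (expPoint (v t) * (expPoint (v t'))⁻¹) := by
    intro t t' htt
    have hco := norm_sub_le_mul_dist1_expPoint (r := π / 2) (by positivity) (by linarith [Real.pi_pos])
      (v t) (v t') (hball t) (hball t')
    rw [Real.sin_pi_div_two, div_one] at hco
    have hsle := hsepv t t' htt
    have : s = π / 2 * (3 * r) := by rw [hs]; ring
    have hd0 : 0 ≤ dist1 (expPoint (v t) * (expPoint (v t'))⁻¹) := GaugeGroup.dist1_nonneg _
    nlinarith [Real.pi_pos, Real.pi_gt_three]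
  -- injectivity and the count
  have hinj : Function.Injective (fun t : Fin n × Fin n × Fin n => expPoint (v t)) := by
    intro t t' h
    by_contra htt
    have h3 := hsep t t' htt
    have h0 : dist1 (expPoint (v t) * (expPoint (v t'))⁻¹) = 0 := by
      simp only [h, mul_inv_cancel, GaugeGroup.dist1_one]
    linarith
  refine ⟨Finset.univ.image (fun t : Fin n × Fin n × Fin n => expPoint (v t)), ?_, ?_⟩
  · rw [Finset.card_image_of_injective _ hinj, Finset.card_univ]
    simp [Fintype.card_prod, Fintype.card_fin, pow_succ, pow_zero]
    ring
  · intro p hp p' hp' hne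
    obtain ⟨t, -, rfl⟩ := Finset.mem_image.1 hp
    obtain ⟨t', -, rfl⟩ := Finset.mem_image.1 hp'
    exact hsep t t' (fun h => hne (by rw [h]))

end Summit.QuantumFields.YangMills.Theorems.FluctuationComparisonRegPrIntLS2BetaSeparatedGridSU2

end
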